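import Mathlib.Analysis.SpecialFunctions.Exp
import Mathlib.Algebra.Order.Field.GeomSum
import Mathlib.Algebra.Order.Floor.Defs
import Mathlib.MeasureTheory.Integral.IntervalIntegral.Basic
import Mathlib.Topology.UniformSpace.HeineCantor
import HarnessLib

/-!
# Route LimitingAbsorption — `RelaxationBoundsInventory`, II: two elementary real-variable sums

Support lemmas for item stmt-AnomalousDissipation-2940 (`RelaxationBoundsInventory`, route
`route-AnomalousDissipation-LimitingAbsorption`), used by the Riemann–Duhamel superposition
`W_N(t) = ∑_{k : kδ < t} δ Θ_k(t - kδ)` (`δ = T/(N+1)`) of homogeneous passive scalars released at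
the phases `kδ`:

* `sum_step_mul_exp_le` — the discrete Duhamel kernel is bounded uniformly in the step:
  `∑_{k : kδ < t} δ e^{-γ(t - kδ)/2} ≤ 2/γ + δ` (geometric series; the continuum value is
  `∫₀ᵗ e^{-γ(t-s)/2} ds ≤ 2/γ`). With the phase-uniform relaxation `‖Θ_k(τ)‖ ≤ √C e^{-γτ/2}‖h‖`
  and Minkowski this gives `‖W_N(t)‖_{L²} ≤ √C ‖h‖ (2/γ + δ)`.
* `tendsto_riemann_sum` — left Riemann sums of a continuous function over uniform partitions of
  `[0,T]` converge to its integral (uniform continuity); this identifies the source term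
  `∑_k δ ∫ h ψ(kδ) → ∫₀ᵀ∫ h ψ` in the weak formulation of the limit `N → ∞`.

## References

* A. Pazy, *Semigroups of Linear Operators and Applications to PDE* (Springer 1983), Ch. 4,
  §4.2, Cor. 2.5 and Ch. 5, §5.1 (Duhamel / variation of constants for the inhomogeneous
  problem). [`Pazy1983`]
-/

noncomputable section

open MeasureTheory Set Filter Function TopologicalSpace Topology
open scoped BigOperators

namespace Summit.AnomalousDissipation.AnomalousDissipation.Theorems

-- D-0017: single-problem summit ⇒ `Summit.AnomalousDissipation.AnomalousDissipation.…` by design.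
set_option linter.dupNamespace false

namespace LapInventory

/-- **The discrete Duhamel kernel is summable uniformly in the step**: for `γ, δ > 0`, `t ≥ 0`,
`∑_{k : kδ < t} δ e^{-γ (t - kδ)/2} ≤ 2/γ + δ` (compare with `∫₀ᵗ e^{-γ(t-s)/2} ds ≤ 2/γ`: the
terms with `kδ < t` are dominated by the geometric series `δ ∑ⱼ e^{-γ δ j/2} = δ/(1 - e^{-γδ/2})`,
and `1 - e^{-x} ≥ x/(1+x)`). [folklore] -/
theorem sum_step_mul_exp_le {γ δ t : ℝ} (hγ : 0 < γ) (hδ : 0 < δ) (ht : 0 ≤ t) (N : ℕ) :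
    ∑ k ∈ Finset.range N, (if (k : ℝ) * δ < t then δ * Real.exp (-(γ * (t - k * δ)) / 2) else 0)
      ≤ 2 / γ + δ := by
  set n₀ : ℕ := ⌊t / δ⌋₊ with hn₀
  set r : ℝ := Real.exp (-(γ * δ) / 2) with hr
  have hr0 : 0 ≤ r := (Real.exp_pos _).le
  have hr1 : r < 1 := by
    rw [hr, Real.exp_lt_one_iff]
    have : 0 < γ * δ := mul_pos hγ hδ
    linarith
  have hn₀le : (n₀ : ℝ) * δ ≤ t := by
    have h := Nat.floor_le (div_nonneg ht hδ.le)
    rw [← hn₀] at h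
    rwa [le_div_iff₀ hδ] at h
  -- termwise domination by the geometric terms
  have hterm : ∀ k ∈ Finset.range N,
      (if (k : ℝ) * δ < t then δ * Real.exp (-(γ * (t - k * δ)) / 2) else 0) ≤
        if k ≤ n₀ then δ * r ^ (n₀ - k) else 0 := by
    intro k _
    by_cases hk : (k : ℝ) * δ < t
    · have hkn : k ≤ n₀ := by
        rw [hn₀]
        refine Nat.le_floor ?_
        rw [le_div_iff₀ hδ]
        exact hk.le
      rw [if_pos hk, if_pos hkn]
      refine mul_le_mul_of_nonneg_left ?_ hδ.le
      rw [hr, ← Real.exp_nat_mul, Real.exp_le_exp, Nat.cast_sub hkn]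
      have : ((n₀ : ℝ) - k) * δ ≤ t - k * δ := by nlinarith
      nlinarith
    · rw [if_neg hk]
      split_ifs
      · exact mul_nonneg hδ.le (pow_nonneg hr0 _)
      · exact le_rfl
  refine (Finset.sum_le_sum hterm).trans ?_
  rw [Finset.sum_ite, Finset.sum_const_zero, add_zero]
  have hsub : (Finset.range N).filter (fun k => k ≤ n₀) ⊆ Finset.range (n₀ + 1) := by
    intro k hk
    rw [Finset.mem_filter] at hk
    exact Finset.mem_range.2 (Nat.lt_succ_of_le hk.2)
  refine (Finset.sum_le_sum_of_subset_of_nonneg hsub fun k _ _ => mul_nonneg hδ.le (pow_nonneg hr0 _)).trans ?_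
  rw [← Finset.mul_sum]
  have hrefl : ∑ k ∈ Finset.range (n₀ + 1), r ^ (n₀ - k) = ∑ j ∈ Finset.range (n₀ + 1), r ^ j := by
    have h := Finset.sum_range_reflect (fun j => r ^ j) (n₀ + 1)
    simp only [Nat.add_sub_cancel] at h
    exact h
  rw [hrefl]
  have hgeom : ∑ j ∈ Finset.range (n₀ + 1), r ^ j ≤ 1 / (1 - r) := by
    have h := geom_sum_Ico_le_of_lt_one (m := 0) (n := n₀ + 1) hr0 hr1
    rwa [pow_zero, ← Finset.range_eq_Ico] at h
  -- `δ / (1 - r) ≤ 2/γ + δ`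
  set x : ℝ := γ * δ / 2 with hx
  have hx0 : 0 < x := by positivity
  have h1r : x / (1 + x) ≤ 1 - r := by
    have hexp : x + 1 ≤ Real.exp x := Real.add_one_le_exp x
    have hrx : r = Real.exp (-x) := by rw [hr, hx]; congr 1; ring
    have hle : r ≤ (1 + x)⁻¹ := by
      rw [hrx, Real.exp_neg]
      exact inv_anti₀ (by linarith) (by linarith)
    have e : x / (1 + x) = 1 - (1 + x)⁻¹ := by
      field_simp
      ring
    rw [e]
    linarith
  calc δ * ∑ j ∈ Finset.range (n₀ + 1), r ^ j ≤ δ * (1 / (1 - r)) :=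
        mul_le_mul_of_nonneg_left hgeom hδ.le
    _ ≤ δ * (1 / (x / (1 + x))) := by
        refine mul_le_mul_of_nonneg_left ?_ hδ.le
        exact div_le_div_of_nonneg_left zero_le_one (div_pos hx0 (by linarith)) h1r
    _ = 2 / γ + δ := by
        rw [hx]
        field_simp

/-- **Riemann sums of a continuous function over uniform partitions converge to its integral**:
for `g` continuous on `[0,T]`, `T > 0`, `∑_{k ≤ N} (T/(N+1)) g(k T/(N+1)) → ∫₀ᵀ g` as `N → ∞`
(uniform continuity on the compact interval). [folklore] -/
theorem tendsto_riemann_sum {g : ℝ → ℝ} {T : ℝ} (hT : 0 < T) (hg : ContinuousOn g (Icc 0 T)) :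
    Tendsto (fun N : ℕ => ∑ k ∈ Finset.range (N + 1), T / (N + 1) * g (k * (T / (N + 1))))
      atTop (𝓝 (∫ t in (0 : ℝ)..T, g t)) := by
  rw [Metric.tendsto_atTop]
  intro ε hε
  -- uniform continuity on `[0, T]`
  have huc : UniformContinuousOn g (Icc 0 T) := isCompact_Icc.uniformContinuousOn_of_continuous hg
  obtain ⟨η, hη, hηg⟩ := Metric.uniformContinuousOn_iff.1 huc (ε / (2 * T)) (by positivity)
  obtain ⟨N₀, hN₀⟩ := exists_nat_gt (T / η)
  refine ⟨N₀, fun N hN => ?_⟩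
  set n : ℕ := N + 1 with hn
  set δ : ℝ := T / (N + 1) with hδ
  have hn0 : (0 : ℝ) < N + 1 := by positivity
  have hδ0 : 0 < δ := div_pos hT hn0
  have hδη : δ < η := by
    rw [hδ, div_lt_iff₀ hn0]
    have h1 : T / η < N + 1 := hN₀.trans_le (by exact_mod_cast Nat.le_succ_of_le hN)
    rw [div_lt_iff₀ hη] at h1
    linarith
  -- the partition `a k = k δ`
  set a : ℕ → ℝ := fun k => k * δ with ha
  have ha0 : a 0 = 0 := by simp [ha]
  have han : a n = T := by
    rw [ha, hn, hδ]; push_cast; field_simp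
  have hak : ∀ k, a (k + 1) - a k = δ := by intro k; simp only [ha]; push_cast; ring
  have hamono : ∀ k, a k ≤ a (k + 1) := fun k => by linarith [hak k, hδ0.le]
  have haIcc : ∀ k, k < n → ∀ s ∈ Icc (a k) (a (k + 1)), s ∈ Icc 0 T := by
    intro k hk s hs
    have h0k : 0 ≤ a k := by simp only [ha]; positivity
    have hk1 : a (k + 1) ≤ T := by
      rw [← han]
      simp only [ha]
      refine mul_le_mul_of_nonneg_right ?_ hδ0.le
      exact_mod_cast hk
    exact ⟨h0k.trans hs.1, hs.2.trans hk1⟩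
  have hint : ∀ k, k < n → IntervalIntegrable g volume (a k) (a (k + 1)) := by
    intro k hk
    refine (hg.mono ?_).intervalIntegrable_of_Icc (hamono k)
    exact fun s hs => haIcc k hk s hs
  have hsum : ∑ k ∈ Finset.range n, ∫ t in a k..a (k + 1), g t = ∫ t in (0 : ℝ)..T, g t := by
    rw [intervalIntegral.sum_integral_adjacent_intervals hint, ha0, han]
  -- each cell contributes at most `δ ε/(2T)`
  have hcell : ∀ k ∈ Finset.range n,
      dist (δ * g (k * δ)) (∫ t in a k..a (k + 1), g t) ≤ ε / (2 * T) * δ := by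
    intro k hk
    have hk' : k < n := Finset.mem_range.1 hk
    have e1 : δ * g (k * δ) = ∫ _ in a k..a (k + 1), g (a k) := by
      rw [intervalIntegral.integral_const, hak k, smul_eq_mul]
    rw [e1, dist_eq_norm, ← intervalIntegral.integral_sub intervalIntegrable_const (hint k hk')]
    have hbd : ∀ s ∈ Set.uIoc (a k) (a (k + 1)), ‖g (a k) - g s‖ ≤ ε / (2 * T) := by
      intro s hs
      rw [uIoc_of_le (hamono k)] at hs
      have hs' : s ∈ Icc (a k) (a (k + 1)) := Ioc_subset_Icc_self hs
      have hks : dist (a k) s < η := by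
        rw [Real.dist_eq, abs_sub_comm, abs_of_nonneg (by linarith [hs'.1])]
        linarith [hs'.2, hak k]
      exact (hηg (a k) (haIcc k hk' _ (left_mem_Icc.2 (hamono k))) s (haIcc k hk' s hs') hks).le
    have h := intervalIntegral.norm_integral_le_of_norm_le_const hbd
    rwa [hak k, abs_of_pos hδ0] at h
  calc dist (∑ k ∈ Finset.range n, δ * g (k * δ)) (∫ t in (0 : ℝ)..T, g t)
      = dist (∑ k ∈ Finset.range n, δ * g (k * δ)) (∑ k ∈ Finset.range n, ∫ t in a k..a (k + 1), g t) := by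
        rw [hsum]
    _ ≤ ∑ k ∈ Finset.range n, dist (δ * g (k * δ)) (∫ t in a k..a (k + 1), g t) := dist_sum_sum_le_of_le _ (fun k _ => le_rfl)
    _ ≤ ∑ k ∈ Finset.range n, ε / (2 * T) * δ := Finset.sum_le_sum hcell
    _ = ε / 2 := by
        rw [Finset.sum_const, Finset.card_range, nsmul_eq_mul, hn, hδ]
        push_cast
        field_simp
    _ < ε := by linarith

end LapInventory

end Summit.AnomalousDissipation.AnomalousDissipation.Theorems

end
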